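import Mathlib.RingTheory.Length
import Mathlib.RingTheory.RingHom.Flat
import Mathlib.RingTheory.Flat.EquationalCriterion
import Mathlib.RingTheory.Ideal.Quotient.Operations
import Mathlib.RingTheory.Ideal.Maximal
import Mathlib.Algebra.BigOperators.Group.Finset.Piecewise
import HarnessLib

/-!
# Lech's lemmas on independent elements (Stacks Project, Section 51.17; Lech 1964)

Support file for the proof of Kunz's regularity criterion (`KunzRegularityCriterionProofs.lean`,
direction "Frobenius flat ⇒ regular"), following The Stacks Project, Section 51.17 "Frobenius
action" (Tags 0EBW, 0EBX, 0EBY, 0EBZ), which in turn follows C. Lech, *Inequalities related to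
certain couples of local rings*, Acta Math. 112 (1964) and Matsumura, *Commutative Algebra*,
Lemmas 1–3, pp. 299–300.

Stacks: *"we say elements `f₁, …, f_r` of a ring `A` are independent if `∑ aᵢfᵢ = 0` implies
`aᵢ ∈ (f₁, …, f_r)`."* We do not introduce a name for this predicate; throughout, for a family
`f : Fin r → A`, "independent" is spelled out as
`∀ a : Fin r → A, ∑ i, a i * f i = 0 → ∀ i, a i ∈ Ideal.span (Set.range f)`, and the family
"`f₁, …, f_{r-1}, f_r g_r`" of the source is `Function.update f i₀ (f i₀ * g)` (the distinguished
index `i₀` need not be the last one).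

* `indep_of_indep_update_mul` — **Tag 0EBW** (Lemma 51.17.2): if `f₁, …, f_{r-1}, f_rg_r` are
  independent then so are `f₁, …, f_r`.
* `length_quotient_update_mul` — **Tag 0EBX** (Lemma 51.17.3): if `f₁, …, f_{r-1}, f_rg_r` are
  independent then
  `ℓ_A(A/(f₁, …, f_{r-1}, f_rg_r)) = ℓ_A(A/(f₁, …, f_r)) + ℓ_A(A/(f₁, …, f_{r-1}, g_r))`
  (lengths in `ℕ∞`, so that no finite-length hypothesis is needed).
* `length_quotient_pow_eq_prod` — **Tag 0EBY** (Lemma 51.17.4): if `𝔪 = (x₁, …, x_r)` is a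
  maximal ideal and `x₁^{e₁}, …, x_r^{e_r}` are independent (`eᵢ > 0`) then
  `ℓ_A(A/(x₁^{e₁}, …, x_r^{e_r})) = e₁ ⋯ e_r`.
* `indep_map_of_flat` — **Tag 0EBZ** (Lemma 51.17.5): a flat ring map preserves independence
  (here via the equational criterion of flatness,
  `Module.Flat.isTrivialRelation_of_sum_smul_eq_zero`, instead of `I/I² ⊗_A B = J/J²`).

## References

* [StacksProject] The Stacks Project, Section 51.17, Tags 0EBW, 0EBX, 0EBY, 0EBZ.
* C. Lech, Acta Math. 112 (1964) 69–89; H. Matsumura, *Commutative Algebra*, pp. 299–300.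
-/

namespace Literature.AlgebraicGeometry.Resolution

universe u v

open Function

namespace Kunz1969

variable {A : Type u} [CommRing A] {r : ℕ}

/-! ### Bookkeeping for the family `f₁, …, f_{r-1}, f_r g_r = update f i₀ (f i₀ * g)` -/

/-- `∑ᵢ (update c i₀ v)ᵢ · (update f i₀ w)ᵢ = v w + ∑_{i ≠ i₀} cᵢ fᵢ`. [folklore] -/
theorem sum_update_mul_update (c f : Fin r → A) (i₀ : Fin r) (v w : A) :
    ∑ i, update c i₀ v i * update f i₀ w i = v * w + ∑ i ∈ Finset.univ.erase i₀, c i * f i := by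
  rw [← Finset.add_sum_erase Finset.univ _ (Finset.mem_univ i₀), update_self, update_self]
  congr 1
  exact Finset.sum_congr rfl fun i hi => by
    rw [update_of_ne (Finset.ne_of_mem_erase hi), update_of_ne (Finset.ne_of_mem_erase hi)]

/-- `∑ᵢ cᵢ · (update f i₀ w)ᵢ = c_{i₀} w + ∑_{i ≠ i₀} cᵢ fᵢ`. [folklore] -/
theorem sum_mul_update (c f : Fin r → A) (i₀ : Fin r) (w : A) :
    ∑ i, c i * update f i₀ w i = c i₀ * w + ∑ i ∈ Finset.univ.erase i₀, c i * f i := by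
  conv_lhs => rw [← update_eq_self i₀ c]
  exact sum_update_mul_update c f i₀ (c i₀) w

/-- `∑ᵢ cᵢ fᵢ = c_{i₀} f_{i₀} + ∑_{i ≠ i₀} cᵢ fᵢ`. [folklore] -/
theorem sum_mul_eq_add_sum_erase (c f : Fin r → A) (i₀ : Fin r) :
    ∑ i, c i * f i = c i₀ * f i₀ + ∑ i ∈ Finset.univ.erase i₀, c i * f i :=
  (Finset.add_sum_erase Finset.univ _ (Finset.mem_univ i₀)).symm

/-- `fᵢ ∈ (f₁, …, f_r)`. [folklore] -/
theorem mem_span_range_self' (f : Fin r → A) (i : Fin r) : f i ∈ Ideal.span (Set.range f) :=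
  Ideal.subset_span (Set.mem_range_self i)

/-- For `i ≠ i₀`, `fᵢ` lies in the ideal generated by `update f i₀ w`. [folklore] -/
theorem mem_span_range_update_of_ne (f : Fin r → A) (i₀ : Fin r) (w : A) {i : Fin r}
    (hi : i ≠ i₀) : f i ∈ Ideal.span (Set.range (update f i₀ w)) :=
  Ideal.subset_span ⟨i, update_of_ne hi w f⟩

/-- `w` lies in the ideal generated by `update f i₀ w`. [folklore] -/
theorem mem_span_range_update_self (f : Fin r → A) (i₀ : Fin r) (w : A) :
    w ∈ Ideal.span (Set.range (update f i₀ w)) :=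
  Ideal.subset_span ⟨i₀, update_self i₀ w f⟩

/-- `∑_{i ≠ i₀} cᵢ fᵢ` lies in the ideal generated by `update f i₀ w`. [folklore] -/
theorem sum_erase_mem_span_range_update (c f : Fin r → A) (i₀ : Fin r) (w : A) :
    ∑ i ∈ Finset.univ.erase i₀, c i * f i ∈ Ideal.span (Set.range (update f i₀ w)) :=
  Submodule.sum_mem _ fun _ hi =>
    Ideal.mul_mem_left _ _ (mem_span_range_update_of_ne f i₀ w (Finset.ne_of_mem_erase hi))

/-- `(f₁, …, f_{r-1}, f_rg_r) ⊆ (f₁, …, f_r)`. [folklore] -/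
theorem span_range_update_mul_le (f : Fin r → A) (i₀ : Fin r) (g : A) :
    Ideal.span (Set.range (update f i₀ (f i₀ * g))) ≤ Ideal.span (Set.range f) := by
  refine Ideal.span_le.mpr (Set.range_subset_iff.mpr fun i => ?_)
  by_cases hi : i = i₀
  · subst hi
    rw [update_self]
    exact Ideal.mul_mem_right _ _ (mem_span_range_self' f i)
  · rw [update_of_ne hi]
    exact mem_span_range_self' f i

/-- `(f₁, …, f_{r-1}, f_rg_r) ⊆ (f₁, …, f_{r-1}, g_r)`. [folklore] -/
theorem span_range_update_mul_le' (f : Fin r → A) (i₀ : Fin r) (g : A) :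
    Ideal.span (Set.range (update f i₀ (f i₀ * g))) ≤ Ideal.span (Set.range (update f i₀ g)) := by
  refine Ideal.span_le.mpr (Set.range_subset_iff.mpr fun i => ?_)
  by_cases hi : i = i₀
  · subst hi
    rw [update_self]
    exact Ideal.mul_mem_left _ _ (mem_span_range_update_self f i g)
  · rw [update_of_ne hi]
    exact mem_span_range_update_of_ne f i₀ g hi

/-! ### Tag 0EBW -/

/-- **Lech's Lemma 1** (The Stacks Project, Tag 0EBW; Matsumura, *Commutative Algebra*, Lemma 1
p. 299): if `f₁, …, f_{r-1}, f_rg_r` are independent, then `f₁, …, f_r` are independent.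
Printed proof: "Say `∑ aᵢfᵢ = 0`. Then `∑ aᵢg_rfᵢ = 0`. Hence `a_r ∈ (f₁, …, f_{r-1}, f_rg_r)`.
Write `a_r = ∑_{i<r} bᵢfᵢ + bf_rg_r`. Then `0 = ∑_{i<r} (aᵢ + bᵢf_r)fᵢ + bf_r²g_r`. Thus
`aᵢ + bᵢf_r ∈ (f₁, …, f_{r-1}, f_rg_r)` which implies `aᵢ ∈ (f₁, …, f_r)`."
[cite: StacksProject, Tag 0EBW (Lemma 51.17.2)] -/
theorem indep_of_indep_update_mul (f : Fin r → A) (i₀ : Fin r) (g : A)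
    (h : ∀ a : Fin r → A, ∑ i, a i * update f i₀ (f i₀ * g) i = 0 →
      ∀ i, a i ∈ Ideal.span (Set.range (update f i₀ (f i₀ * g)))) :
    ∀ a : Fin r → A, ∑ i, a i * f i = 0 → ∀ i, a i ∈ Ideal.span (Set.range f) := by
  intro a ha
  have hle := span_range_update_mul_le f i₀ g
  have ha' : a i₀ * f i₀ + ∑ i ∈ Finset.univ.erase i₀, a i * f i = 0 := by
    rwa [sum_mul_eq_add_sum_erase a f i₀] at ha
  -- `∑ aᵢ g fᵢ = 0`, read as a relation among `f₁, …, f_{r-1}, f_rg_r`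
  have h1 : ∑ i, update (fun i => a i * g) i₀ (a i₀) i * update f i₀ (f i₀ * g) i = 0 := by
    rw [sum_update_mul_update]
    have hsum : ∑ i ∈ Finset.univ.erase i₀, a i * g * f i =
        g * ∑ i ∈ Finset.univ.erase i₀, a i * f i := by
      rw [Finset.mul_sum]
      exact Finset.sum_congr rfl fun i _ => by ring
    rw [hsum]
    linear_combination g * ha'
  -- hence `a_r ∈ (f₁, …, f_{r-1}, f_rg_r)`; write `a_r = ∑_{i<r} bᵢfᵢ + b f_rg_r`
  have hai₀ : a i₀ ∈ Ideal.span (Set.range (update f i₀ (f i₀ * g))) := by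
    have := h _ h1 i₀
    rwa [update_self] at this
  obtain ⟨b, hb⟩ := Ideal.mem_span_range_iff_exists_fun.mp hai₀
  rw [sum_mul_update] at hb
  -- `0 = ∑_{i<r} (aᵢ + bᵢf_r)fᵢ + bf_r²g_r`
  have h2 : ∑ i, update (fun i => a i + b i * f i₀) i₀ (b i₀ * f i₀) i *
      update f i₀ (f i₀ * g) i = 0 := by
    rw [sum_update_mul_update]
    have hsum : ∑ i ∈ Finset.univ.erase i₀, (a i + b i * f i₀) * f i =
        ∑ i ∈ Finset.univ.erase i₀, a i * f i + f i₀ * ∑ i ∈ Finset.univ.erase i₀, b i * f i := by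
      rw [Finset.mul_sum, ← Finset.sum_add_distrib]
      exact Finset.sum_congr rfl fun i _ => by ring
    rw [hsum]
    linear_combination f i₀ * hb + ha'
  intro i
  by_cases hi : i = i₀
  · subst hi
    exact hle hai₀
  · have h3 := h _ h2 i
    rw [update_of_ne hi] at h3
    have h4 : b i * f i₀ ∈ Ideal.span (Set.range f) :=
      Ideal.mul_mem_left _ _ (mem_span_range_self' f i₀)
    have h5 := Ideal.sub_mem _ (hle h3) h4
    rwa [add_sub_cancel_right] at h5

/-! ### Tag 0EBX -/

/-- **Lech's Lemma 2** (The Stacks Project, Tag 0EBX; Matsumura, *Commutative Algebra*, Lemma 2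
p. 300): if `f₁, …, f_{r-1}, f_rg_r` are independent, then
`ℓ_A(A/(f₁, …, f_{r-1}, f_rg_r)) = ℓ_A(A/(f₁, …, f_{r-1}, g_r)) + ℓ_A(A/(f₁, …, f_r))`.
Printed proof: the sequence
`0 → A/(f₁, …, f_{r-1}, g_r) —f_r→ A/(f₁, …, f_{r-1}, f_rg_r) → A/(f₁, …, f_r) → 0` is exact
("if `af_r ∈ (f₁, …, f_{r-1}, f_rg_r)`, then `∑_{i<r} aᵢfᵢ + (a + bg_r)f_r = 0` for some
`b, aᵢ ∈ A`. Hence `∑_{i<r} aᵢg_rfᵢ + (a + bg_r)g_rf_r = 0` which implies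
`a + bg_r ∈ (f₁, …, f_{r-1}, f_rg_r)` which means that `a` maps to zero in
`A/(f₁, …, f_{r-1}, g_r)`"), and length is additive. Lengths are taken in `ℕ∞`
(`Module.length`), so the finite-length hypothesis of the source is not needed.
[cite: StacksProject, Tag 0EBX (Lemma 51.17.3)] -/
theorem length_quotient_update_mul (f : Fin r → A) (i₀ : Fin r) (g : A)
    (h : ∀ a : Fin r → A, ∑ i, a i * update f i₀ (f i₀ * g) i = 0 →
      ∀ i, a i ∈ Ideal.span (Set.range (update f i₀ (f i₀ * g)))) :
    Module.length A (A ⧸ Ideal.span (Set.range (update f i₀ (f i₀ * g)))) =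
      Module.length A (A ⧸ Ideal.span (Set.range (update f i₀ g))) +
        Module.length A (A ⧸ Ideal.span (Set.range f)) := by
  have hFg := span_range_update_mul_le' f i₀ g
  have hFf := span_range_update_mul_le f i₀ g
  -- `φ : A/(f₁, …, f_{r-1}, g_r) → A/(f₁, …, f_{r-1}, f_rg_r)`, multiplication by `f_r`
  have hker : (Ideal.span (Set.range (update f i₀ g)) : Submodule A A) ≤ LinearMap.ker
      (f i₀ • Submodule.mkQ (Ideal.span (Set.range (update f i₀ (f i₀ * g))) : Submodule A A)) := by
    refine Ideal.span_le.mpr (Set.range_subset_iff.mpr fun i => ?_)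
    rw [SetLike.mem_coe, LinearMap.mem_ker, LinearMap.smul_apply, Submodule.mkQ_apply,
      ← Submodule.Quotient.mk_smul, Submodule.Quotient.mk_eq_zero, smul_eq_mul]
    by_cases hi : i = i₀
    · subst hi
      rw [update_self]
      exact mem_span_range_update_self f i (f i * g)
    · rw [update_of_ne hi]
      exact Ideal.mul_mem_left _ _ (mem_span_range_update_of_ne f i₀ _ hi)
  obtain ⟨φ, hφ⟩ : ∃ φ : (A ⧸ Ideal.span (Set.range (update f i₀ g))) →ₗ[A]
      (A ⧸ Ideal.span (Set.range (update f i₀ (f i₀ * g)))),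
      ∀ c : A, φ (Submodule.Quotient.mk c) = Submodule.Quotient.mk (f i₀ * c) :=
    ⟨Submodule.liftQ _ _ hker, fun c => by
      rw [Submodule.liftQ_apply, LinearMap.smul_apply, Submodule.mkQ_apply,
        ← Submodule.Quotient.mk_smul, smul_eq_mul]⟩
  -- `ψ : A/(f₁, …, f_{r-1}, f_rg_r) → A/(f₁, …, f_r)`, the projection
  have hker' : (Ideal.span (Set.range (update f i₀ (f i₀ * g))) : Submodule A A) ≤
      LinearMap.ker (Submodule.mkQ (Ideal.span (Set.range f) : Submodule A A)) := by
    rwa [Submodule.ker_mkQ]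
  obtain ⟨ψ, hψ⟩ : ∃ ψ : (A ⧸ Ideal.span (Set.range (update f i₀ (f i₀ * g)))) →ₗ[A]
      (A ⧸ Ideal.span (Set.range f)),
      ∀ c : A, ψ (Submodule.Quotient.mk c) = Submodule.Quotient.mk c :=
    ⟨Submodule.liftQ _ _ hker', fun c => by rw [Submodule.liftQ_apply, Submodule.mkQ_apply]⟩
  -- `φ` is injective: this is where independence enters
  have hφinj : Function.Injective φ := by
    refine (injective_iff_map_eq_zero φ).mpr fun z hz => ?_
    obtain ⟨c, rfl⟩ := Submodule.Quotient.mk_surjective _ z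
    rw [hφ, Submodule.Quotient.mk_eq_zero] at hz
    obtain ⟨d, hd⟩ := Ideal.mem_span_range_iff_exists_fun.mp hz
    rw [sum_mul_update] at hd
    -- `∑_{i<r} (-dᵢ g) fᵢ + (c - d_r g) f_rg_r = 0`
    have hrel : ∑ i, update (fun i => -(d i * g)) i₀ (c - d i₀ * g) i *
        update f i₀ (f i₀ * g) i = 0 := by
      rw [sum_update_mul_update]
      have hsum : ∑ i ∈ Finset.univ.erase i₀, -(d i * g) * f i =
          -(g * ∑ i ∈ Finset.univ.erase i₀, d i * f i) := by
        rw [Finset.mul_sum, ← Finset.sum_neg_distrib]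
        exact Finset.sum_congr rfl fun i _ => by ring
      rw [hsum]
      linear_combination (-g) * hd
    have hmem := h _ hrel i₀
    rw [update_self] at hmem
    have h6 : d i₀ * g ∈ Ideal.span (Set.range (update f i₀ g)) :=
      Ideal.mul_mem_left _ _ (mem_span_range_update_self f i₀ g)
    have h7 := Ideal.add_mem _ (hFg hmem) h6
    rw [sub_add_cancel] at h7
    rwa [Submodule.Quotient.mk_eq_zero]
  have hψsurj : Function.Surjective ψ := by
    intro z
    obtain ⟨c, rfl⟩ := Submodule.Quotient.mk_surjective _ z
    exact ⟨Submodule.Quotient.mk c, hψ c⟩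
  have hexact : Function.Exact φ ψ := by
    intro z
    obtain ⟨c, rfl⟩ := Submodule.Quotient.mk_surjective _ z
    rw [hψ, Submodule.Quotient.mk_eq_zero]
    constructor
    · intro hc
      obtain ⟨d, hd⟩ := Ideal.mem_span_range_iff_exists_fun.mp hc
      rw [sum_mul_eq_add_sum_erase d f i₀] at hd
      refine ⟨Submodule.Quotient.mk (d i₀), ?_⟩
      rw [hφ, Submodule.Quotient.eq]
      have hS := sum_erase_mem_span_range_update d f i₀ (f i₀ * g)
      have heq : f i₀ * d i₀ - c = -∑ i ∈ Finset.univ.erase i₀, d i * f i := by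
        linear_combination hd
      rw [heq]
      exact Submodule.neg_mem _ hS
    · rintro ⟨w, hw⟩
      obtain ⟨a, rfl⟩ := Submodule.Quotient.mk_surjective _ w
      rw [hφ, Submodule.Quotient.eq] at hw
      have h8 : f i₀ * a ∈ Ideal.span (Set.range f) :=
        Ideal.mul_mem_right _ _ (mem_span_range_self' f i₀)
      have h9 := Ideal.sub_mem _ h8 (hFf hw)
      rwa [sub_sub_cancel] at h9
  exact Module.length_eq_add_of_exact φ ψ hφinj hψsurj hexact

/-! ### Tag 0EBY -/

/-- **Lech's Lemma 3** (The Stacks Project, Tag 0EBY; Matsumura, *Commutative Algebra*, Lemma 3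
p. 300), with the sum of the exponents named for the induction: if `𝔪 = (x₁, …, x_r)` is a
maximal ideal of `A` and `x₁^{e₁}, …, x_r^{e_r}` are independent for some `eᵢ > 0`, then
`ℓ_A(A/(x₁^{e₁}, …, x_r^{e_r})) = e₁ ⋯ e_r`. Printed proof: "Use Lemmas 0EBW and 0EBX and
induction" — on `∑ eᵢ`: if all `eᵢ = 1` the quotient is the residue field; otherwise split
`x_{i₀}^{e_{i₀}} = x_{i₀}^{e_{i₀}-1} · x_{i₀}`. [cite: StacksProject, Tag 0EBY (Lemma 51.17.4)] -/
theorem length_quotient_pow_eq_prod_aux (x : Fin r → A)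
    (hm : (Ideal.span (Set.range x)).IsMaximal) :
    ∀ (N : ℕ) (e : Fin r → ℕ), ∑ i, e i = N → (∀ i, 1 ≤ e i) →
      (∀ a : Fin r → A, ∑ i, a i * (fun i => x i ^ e i) i = 0 →
        ∀ i, a i ∈ Ideal.span (Set.range fun i => x i ^ e i)) →
      Module.length A (A ⧸ Ideal.span (Set.range fun i => x i ^ e i)) = ((∏ i, e i : ℕ) : ℕ∞) := by
  intro N
  induction N using Nat.strong_induction_on with
  | _ N ih =>
  intro e hN he hind
  by_cases hall : ∀ i, e i = 1
  · have hfam : (fun i => x i ^ e i) = x := funext fun i => by rw [hall i, pow_one]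
    rw [hfam, Finset.prod_eq_one fun i _ => hall i, Nat.cast_one]
    haveI : IsSimpleModule A (A ⧸ Ideal.span (Set.range x)) :=
      isSimpleModule_iff_isCoatom.mpr (Ideal.isMaximal_def.mp hm)
    exact Module.length_eq_one _ _
  · push Not at hall
    obtain ⟨i₀, hi₀⟩ := hall
    obtain ⟨k, hk⟩ : ∃ k, e i₀ = k + 1 + 1 := ⟨e i₀ - 2, by have := he i₀; omega⟩
    obtain ⟨e₁, he₁⟩ : ∃ e₁ : Fin r → ℕ, e₁ = update e i₀ (k + 1) := ⟨_, rfl⟩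
    obtain ⟨e₂, he₂⟩ : ∃ e₂ : Fin r → ℕ, e₂ = update e i₀ 1 := ⟨_, rfl⟩
    have he₁i₀ : e₁ i₀ = k + 1 := by rw [he₁, update_self]
    have he₂i₀ : e₂ i₀ = 1 := by rw [he₂, update_self]
    have he₁i : ∀ i, i ≠ i₀ → e₁ i = e i := fun i hi => by rw [he₁, update_of_ne hi]
    have he₂i : ∀ i, i ≠ i₀ → e₂ i = e i := fun i hi => by rw [he₂, update_of_ne hi]
    -- `x^e = (x^{e₁} with x_{i₀}^{k+1} replaced by x_{i₀}^{k+1} · x_{i₀})`, `x^{e₂}` likewise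
    have hfam : update (fun i => x i ^ e₁ i) i₀ ((fun i => x i ^ e₁ i) i₀ * x i₀) =
        fun i => x i ^ e i := by
      funext i
      by_cases hi : i = i₀
      · rw [hi, update_self]
        change x i₀ ^ e₁ i₀ * x i₀ = x i₀ ^ e i₀
        rw [he₁i₀, hk, ← pow_succ]
      · simp only [update_of_ne hi, he₁i i hi]
    have hfam₂ : update (fun i => x i ^ e₁ i) i₀ (x i₀) = fun i => x i ^ e₂ i := by
      funext i
      by_cases hi : i = i₀
      · rw [hi, update_self, he₂i₀, pow_one]
      · simp only [update_of_ne hi, he₁i i hi, he₂i i hi]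
    rw [← hfam] at hind ⊢
    -- independence of `x^{e₁}` (Lemma 1) and of `x^{e₂}` (Lemma 1 with the roles exchanged)
    have hind₁ := indep_of_indep_update_mul (fun i => x i ^ e₁ i) i₀ (x i₀) hind
    have hind₂ : ∀ a : Fin r → A, ∑ i, a i * (fun i => x i ^ e₂ i) i = 0 →
        ∀ i, a i ∈ Ideal.span (Set.range fun i => x i ^ e₂ i) := by
      rw [← hfam₂]
      refine indep_of_indep_update_mul (update (fun i => x i ^ e₁ i) i₀ (x i₀)) i₀
        (x i₀ ^ e₁ i₀) ?_
      rwa [update_idem, update_self, mul_comm]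
    -- the lengths (Lemma 2) and the induction hypotheses
    rw [length_quotient_update_mul (fun i => x i ^ e₁ i) i₀ (x i₀) hind, hfam₂]
    have hS : ∑ i, e i = e i₀ + ∑ i ∈ Finset.univ \ {i₀}, e i :=
      Finset.sum_eq_add_sum_sdiff_singleton_of_mem (Finset.mem_univ i₀) e
    have hS₁ : ∑ i, e₁ i = (k + 1) + ∑ i ∈ Finset.univ \ {i₀}, e i := by
      rw [he₁]; exact Finset.sum_update_of_mem (Finset.mem_univ i₀) e (k + 1)
    have hS₂ : ∑ i, e₂ i = 1 + ∑ i ∈ Finset.univ \ {i₀}, e i := by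
      rw [he₂]; exact Finset.sum_update_of_mem (Finset.mem_univ i₀) e 1
    have hP : ∏ i, e i = e i₀ * ∏ i ∈ Finset.univ \ {i₀}, e i :=
      Finset.prod_eq_mul_prod_sdiff_singleton_of_mem (Finset.mem_univ i₀) e
    have hP₁ : ∏ i, e₁ i = (k + 1) * ∏ i ∈ Finset.univ \ {i₀}, e i := by
      rw [he₁]; exact Finset.prod_update_of_mem (Finset.mem_univ i₀) e (k + 1)
    have hP₂ : ∏ i, e₂ i = 1 * ∏ i ∈ Finset.univ \ {i₀}, e i := by
      rw [he₂]; exact Finset.prod_update_of_mem (Finset.mem_univ i₀) e 1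
    have h1e₁ : ∀ i, 1 ≤ e₁ i := fun i => by
      by_cases hi : i = i₀
      · rw [hi, he₁i₀]; omega
      · rw [he₁i i hi]; exact he i
    have h1e₂ : ∀ i, 1 ≤ e₂ i := fun i => by
      by_cases hi : i = i₀
      · rw [hi, he₂i₀]
      · rw [he₂i i hi]; exact he i
    rw [ih _ (by omega) e₁ rfl h1e₁ hind₁, ih _ (by omega) e₂ rfl h1e₂ hind₂, ← Nat.cast_add,
      hP, hP₁, hP₂, hk]
    congr 1
    ring

/-- **Lech's Lemma 3** (The Stacks Project, Tag 0EBY; Matsumura, *Commutative Algebra*, Lemma 3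
p. 300): if `𝔪 = (x₁, …, x_r)` is a maximal ideal of `A` and `x₁^{e₁}, …, x_r^{e_r}` are
independent for some `eᵢ > 0`, then `ℓ_A(A/(x₁^{e₁}, …, x_r^{e_r})) = e₁ ⋯ e_r`.
[cite: StacksProject, Tag 0EBY (Lemma 51.17.4)] -/
theorem length_quotient_pow_eq_prod (x : Fin r → A) (hm : (Ideal.span (Set.range x)).IsMaximal)
    (e : Fin r → ℕ) (he : ∀ i, 1 ≤ e i)
    (hind : ∀ a : Fin r → A, ∑ i, a i * x i ^ e i = 0 →
      ∀ i, a i ∈ Ideal.span (Set.range fun i => x i ^ e i)) :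
    Module.length A (A ⧸ Ideal.span (Set.range fun i => x i ^ e i)) = ((∏ i, e i : ℕ) : ℕ∞) :=
  length_quotient_pow_eq_prod_aux x hm _ e rfl he hind

/-! ### Tag 0EBZ -/

/-- **Independence is preserved by flat ring maps** (The Stacks Project, Tag 0EBZ,
Lemma 51.17.5): if `φ : A → B` is flat and `f₁, …, f_r ∈ A` are independent, then
`φ(f₁), …, φ(f_r) ∈ B` are independent. (Stacks: "`I/I² ⊗_A B = J/J²`"; here: a relation
`∑ bᵢ φ(fᵢ) = 0` is trivial by the equational criterion of flatness, i.e. `bᵢ = ∑ⱼ φ(aᵢⱼ) yⱼ`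
with `∑ᵢ fᵢ aᵢⱼ = 0`, so `aᵢⱼ ∈ (f)` and `bᵢ ∈ (φ(f))`.)
[cite: StacksProject, Tag 0EBZ (Lemma 51.17.5)] -/
theorem indep_map_of_flat {B : Type v} [CommRing B] (φ : A →+* B) (hφ : φ.Flat) {f : Fin r → A}
    (hf : ∀ a : Fin r → A, ∑ i, a i * f i = 0 → ∀ i, a i ∈ Ideal.span (Set.range f)) :
    ∀ b : Fin r → B, ∑ i, b i * φ (f i) = 0 →
      ∀ i, b i ∈ Ideal.span (Set.range fun i => φ (f i)) := by
  algebraize [φ]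
  intro b hb i
  have hrel : ∑ i, f i • b i = 0 := by
    rw [← hb]
    exact Finset.sum_congr rfl fun i _ => by rw [Algebra.smul_def, mul_comm]; rfl
  obtain ⟨k, a, y, hby, hay⟩ := Module.Flat.isTrivialRelation_of_sum_smul_eq_zero hrel
  rw [hby i]
  refine Submodule.sum_mem _ fun j _ => ?_
  have haij : a i j ∈ Ideal.span (Set.range f) := hf (fun i => a i j) (by
    rw [← hay j]
    exact Finset.sum_congr rfl fun i _ => mul_comm _ _) i
  rw [Algebra.smul_def]
  refine Ideal.mul_mem_right _ _ ?_
  have hmap : (Ideal.span (Set.range f)).map (algebraMap A B) =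
      Ideal.span (Set.range fun i => φ (f i)) := by
    rw [Ideal.map_span, ← Set.range_comp]
    rfl
  exact hmap ▸ Ideal.mem_map_of_mem _ haij

end Kunz1969

end Literature.AlgebraicGeometry.Resolution
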